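/-
Copyright: lit-balaban Phase-2 proof seat p29 (gen 30).  Statement-level skeleton of a published paper; no proof claims beyond what the
kernel checks below.
-/
import Literature.MathematicalPhysics.QuantumFieldTheory.BalabanImbrieJaffe1984to88.BIJ88LocDeriv231TorusOfInputs
import Literature.MathematicalPhysics.QuantumFieldTheory.BalabanImbrieJaffe1984to88.BIJ88DeltaLocClose235General
import Literature.MathematicalPhysics.QuantumFieldTheory.BalabanImbrieJaffe1984to88.BIJ88LocDeriv230SmallFieldTorus

/-!
# `BalabanImbrieJaffe1984to88.BIJ88LocHolder231TorusOfInputs` — T. Bałaban, J. Imbrie, A. Jaffe, *Effective action and cluster properties of the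
abelian Higgs model*, Commun. Math. Phys. **114** (1988) 257–315 [BalabanImbrieJaffe1988], Sect. 2 p. 263 [PDF 7], (2.31) and the sentence after
(2.33): *"Bounds analogous to (2.30), (2.31) hold for covariant derivatives and Hölder derivatives of G_{k,loc}(u) of order less than two"* —
**THE VALUE MEMBER AND THE HÖLDER MEMBER OF ORDER `θ ≤ 1` OF (2.31) WITH `Ω = T_η`, FOR THE PRINTED LOCALIZATION DATA OF RECORD, AT AN ARBITRARY
`U(1)` FIELD `u`, FROM THE FOUR [6]-INPUTS AS HYPOTHESES** — the companions of `BIJ88LocDeriv231TorusOfInputs.deriv231_wholeTorus_of_inputs`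
(the covariant-derivative member) in the same hypothesis form, and the background-independent KERNEL of every Hölder-`θ ≤ 1` member of the
lane (gen 28's `holder231_flat_cwt`, gen 29's `holder231_regular_torus_cwt`): the weighted transported difference from per-bond covariant-derivative
bounds and end-point value bounds.

statement-level skeleton of published theorems with citation tags; proofs where landed; nothing here is a claim about the Yang–Mills mass gap

PDF held: `paper:balaban1988-cmp114-bij-abelian-higgs-effective-action` (journal page = PDF page + 256); p. 263 [PDF 7] re-read this session (text
layer `lit read … --pages 7`).  [6] = [Balaban1983RegularityDecay] (Commun. Math. Phys. **89** (1983) 571–597), Theorem p. 573, (1.9):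
*"(L^k/|x − x′|)^α|U(A(Γ_{x,x′}))(D^η_A G f)(x′) − …|"* is the printed SHAPE of a Hölder member (parallel transport along a contour, weight
`(L^k/|x − x′|)^α`); here the order is `θ ≤ 1` and the function is `ψ = G_{k,loc}(u)f − G_k(T_η,u)f` itself.

CITATION HEADER (lean-in-tree rule).  Part of the lit-balaban TYPED SKELETON (HOME `run/shared/lean/pub/lit-balaban/`), PHASE-2 proof seat
p29 gen 30 (unit `lit-balaban-p29-g30`; TAKING #3 line HOME/STATUS.md 2026-08-23 — own lineage: gen 28 `BIJ88LocHolder231FlatTorus`, gen 29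
`BIJ88LocHolder231RegularTorus` (the telescoping proof, here abstracted), this gen's `BIJ88LocDeriv231TorusOfInputs`; free-target protocol
G.5-34(d)).  Rows **C2.Eq2.31** / **C2.Claim@263** (owner r18; heads = p02's / p08's abstract hence-step, unchanged — these are LOCATED,
HYPOTHESIS-FORM members).  Kind: theorems only (no definition, no `Prop`-valued fact; gen 26–30's, r18's, p31's, T4's declarations BY NAME).

THE PRINTED TEXT (p. 263, verbatim, print order).  *"|(G_{k,loc}(u)f − G_k(Ω,u)f)(x)| ≦ e^{−cr(e_k)}e^{−c dist(suppt f,x)}‖f‖_∞, (2.31) for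
dist(x, Ω^c) ≧ O(r(e_k)). [Each G_k(□_α,u) is close to G_k(Ω,u) for the relevant x₁, x₂, therefore the convex combination and G_{k,loc} are close
also.] We assume that u is smooth in the □_α's entering the sum in (2.27); for (2.31) we assume smoothness throughout the subset Ω ⊂ T_η. …
Bounds analogous to (2.30), (2.31) hold for covariant derivatives and Hölder derivatives of G_{k,loc}(u) of order less than two."*

THE MECHANISM (declared).  §1 KERNEL (any function `ψ`, any field `u`, any bond chain `Γ` of `n ≤ κ|x₁ − x₂|_T` steps): NEAR PAIRS
(`|x₁ − x₂|_T ≤ L^k`): `u(Γ)ψ(x₂) − ψ(x₁)` telescopes into `ε·Σ_m(transport)·D_uψ(c_m)` (gen 28's `norm_transport_sub_le_sum_covD`), so a per-bond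
bound `‖D_uψ(c_m)‖ ≤ (L^kε)X` gives `(L^k/T)^θ·nε(L^kε)X ≤ (L^k/T)·κTε·(L^kε)X = (L^kε)²κX` (`(L^k/T)^θ ≤ L^k/T` as `L^k/T ≥ 1`, `θ ≤ 1`);
FAR PAIRS: `(L^k/T)^θ ≤ 1`, `|u(Γ)| = 1`, two end-point values `≤ (L^kε)²Y` each.  §2 THE VALUE MEMBER from (H2) (the (1.11)–(1.12) value
closeness for the fitting cubes at `ρ`-deep rows) and (H4) (the (1.10) value member of `G_k(T_η,u)`): p31's generic `opClose231_gen` with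
`X₀ = T_η`, `X_α` = the `ρ`-deep rows of `□_α`, row hypotheses (i)–(iii) of the printed data (gen 26's `rowHyp_i`/`rowHyp_iii`, r18's
`rowHyp_ii_torus` at chart depth `≥ R₀ + R`), multiplicity `#S ≤ m` (gen 26's `card_subtype_activeLabels_le`).  §3 THE HÖLDER MEMBER: §1 with
`X` ← this gen's `deriv231_wholeTorus_of_inputs` on every bond of `Γ` (both ends are contour sites, hence in `Ω₀` at chart depth `≥ R₀ + R`;
the support of `f` is at distance `≥ D − |x₁ − x₂|_T ≥ D − L^k` from the bond — whence the displayed factor `e^{δ₀/2}`), `Y` ← §2 at both end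
points (its bracket `m·e^{−2δ₀R/L^k} + e^{−(δ₀/2)R₁/L^k}` is dominated by the derivative member's).  §4: along the chart staircase of gen 28
(`exists_admissible_contour`) the contour hypothesis of §3 is met for every pair of deep points with `|x₁ − x₂|_T ≤ R₀ + R`.

WHAT IS PROVED (theorems only; 0 `sorry`; standard axioms).
* §1 **`weighted_transport_sub_le`** — the kernel: `(L^k/|x₁ − x₂|_T)^θ·‖u(Γ)ψ(x₂) − ψ(x₁)‖ ≤ (L^kε)²(κX + 2Y)` for ANY `ψ`, `u`, `0 ≤ θ ≤ 1`,
  chain `Γ` of `n ≤ κ|x₁ − x₂|_T` steps, GIVEN `‖D_uψ(c_m)‖ ≤ (L^kε)X` on the bonds of `Γ` if `|x₁ − x₂|_T ≤ L^k` and `‖ψ(x_i)‖ ≤ (L^kε)²Y` at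
  both ends if `|x₁ − x₂|_T > L^k`.
* §2 **`close231_wholeTorus_of_inputs`** — (2.31), `Ω = T_η`, operator form, printed data, arbitrary `u`, from (H2), (H4) (binder shapes of
  `deriv231_wholeTorus_of_inputs`): for every `x ∈ Ω₀` at chart depth `≥ R₀ + R` (`R ≥ ρ`), every `f` (`‖f‖_∞ ≤ F`) supported at sup-torus
  distance `≥ D ≥ 0` from `x`: `|(G_{k,loc}(u)f − G_k(T_η,u)f)(x)| ≤ (L^kε)²·c₀·[m·e^{−2δ₀R/L^k} + e^{−(δ₀/2)R₁/L^k}]·e^{−(δ₀/2)D/L^k}·F`.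
* §3 **`holder231_wholeTorus_of_inputs`** — for every `d`, `c₀ ≥ 0` THERE IS `C > 0` such that, with (H1)–(H4) and the data of
  `deriv231_wholeTorus_of_inputs` (`R > ρ + 1`), for every `0 ≤ θ ≤ 1`, every pair `x₁, x₂` joined by a bond chain `Γ` of `≤ (d+1)|x₁ − x₂|_T`
  steps whose sites lie in `Ω₀` at chart depth `≥ R₀ + R` and within `|x₁ − x₂|_T` of `x₁`, every `f` (`‖f‖_∞ ≤ F`) supported at sup-torus
  distance `≥ D ≥ 0` from both points, `ψ = G_{k,loc}(u)f − G_k(T_η,u)f`: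
  `(L^k/|x₁ − x₂|_T)^θ·‖u(Γ)ψ(x₂) − ψ(x₁)‖ ≤ (L^kε)²·C·e^{δ₀/2}·[m(1 + L^k((R₀−R₁)⁻¹ + s⁻¹))e^{−δ₀(2R−1)/L^k} + (1 + L^k(R₀−R₁)⁻¹)e^{−(δ₀/2)(R₁−1)/L^k}]·
  e^{−(δ₀/2)D/L^k}·F`, `C = (d+1)C₁ + 2c₀` (`C₁` = the constant of `deriv231_wholeTorus_of_inputs`).
* §4 **`exists_contour_holder231_wholeTorus_of_inputs`** — for every pair `x₁, x₂ ∈ Ω₀` at chart depth `≥ R₀ + R` with `|x₁ − x₂|_T ≤ R₀ + R`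
  THERE IS such a chain (gen 28's chart staircase) along which §3's bound holds for every `θ` and `f`.
HONEST SCOPE / DIVERGENCE.  (i) HYPOTHESIS FORM, as `BIJ88LocDeriv231TorusOfInputs` (nothing asserted about which `u` admit (H1)–(H4); providers of
record listed there).  (ii) `Ω = T_η` only.  (iii) ORDER `θ ≤ 1` of the VALUE `ψ` (the order-`(1+θ)` member — Hölder quotient of `D_uψ` — is r18's
lane: `BIJ88LocDerivHolder231RegularTorus` at regular `u`; its small-u inputs are p30 gen 28's / p27 gen 37's files).  (iv) The transport is T4's
`chainHol` along the given chain (print's `U(A(Γ_{x,x′}))` along *a* shortest contour; §4 supplies the chart staircase, `≤ (d+1)|x₁ − x₂|_T`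
steps, not a geodesic).  (v) The factor `e^{δ₀/2}` (`≤ e^{1/2}` at the rates of record) is displayed, not absorbed, so that `C` depends on
`d, c₀` only.  (vi) DEEP PAIRS ONLY (chart depth `≥ R₀ + R`; print's *"dist(x, Ω^c) ≧ O(r(e_k))"*).  (vii) Constants not optimized.
`set_option maxHeartbeats 400000` on §§2–3 (elaboration of the long statements only).  Imports: this gen's `BIJ88LocDeriv231TorusOfInputs`
(→ r18 `BIJ88Close231WholeTorusFlatCwt`), p31's `BIJ88DeltaLocClose235General` (`opClose231_gen`), gen 28's `BIJ88LocDeriv230SmallFieldTorus`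
(`norm_transport_sub_le_sum_covD`, `exists_admissible_contour`).  Literature + Mathlib only.  Unit `lit-balaban-p29`
(literature-prover-lit-balaban-p29-g30-0), 2026-08-23.  NOT summit progress.
-/

open scoped BigOperators Matrix ComplexConjugate
open Finset Matrix

namespace Literature.MathematicalPhysics.QuantumFieldTheory.BalabanImbrieJaffe1984to88.BIJ88LocHolder231TorusOfInputs

open Literature.MathematicalPhysics.QuantumFieldTheory.Balaban1983to89
open BIJ88Sect3Statements (U1 toC cfg covD norm_toC)
open BIJ85BlockAveragesTorus BIJ85BlockAveragesTorusK
open BIJ88NeumannPropagator227Torus (gBox)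
open BIJ88DeltaLoc234Torus (gLocT)
open BIJ88NeumannPropagatorFlatDecayCube (cubeT boxCoord)
open BIJ88Cutoffs21 (cutoff cutoff_nonneg cutoff_le_one)
open BIJ88LocWeights227Torus
open BIJ88Close231WholeTorusFlatCwt (rowHyp_ii_torus)
open BIJ88DeltaLocClose235General (opClose231_gen)
open BIJ88LocDeriv230SmallFieldTorus (norm_transport_sub_le_sum_covD exists_admissible_contour)
open BIJ88LocDeriv231TorusOfInputs (deriv231_wholeTorus_of_inputs)
open T4TreeGaugeFixing (Joins)
open T4TreeGaugeTransform (chainHol)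

noncomputable section

variable {d : ℕ} {P : Params}

/-! ## §1 The kernel of the Hölder members of order `θ ≤ 1`: weighted transported differences -/

/-- kernel: for `1 ≤ t` and `θ ≤ 1`, `t^θ ≤ t`. [folklore] -/
private theorem rpow_le_self_of_one_le {t θ : ℝ} (ht : 1 ≤ t) (hθ : θ ≤ 1) : t ^ θ ≤ t := by
  have h := Real.rpow_le_rpow_of_exponent_le ht hθ
  rwa [Real.rpow_one] at h

/-- **KERNEL OF THE HÖLDER MEMBERS OF ORDER `θ ≤ 1`: the weighted transported difference from per-bond covariant-derivative bounds (near
pairs) and end-point value bounds (far pairs).**  For any function `ψ` on the fine torus, any `U(1)` field `u`, any bond chain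
`Γ = (x₁ = s_0, …, s_n = x₂)` of `n ≤ κ|x₁ − x₂|_T` steps: if `‖D_uψ(c_m)‖ ≤ (L^kε)·X` on every bond of `Γ` whenever `|x₁ − x₂|_T ≤ L^k`, and
`‖ψ(x_i)‖ ≤ (L^kε)²·Y` at both end points whenever `|x₁ − x₂|_T > L^k`, then for every `0 ≤ θ ≤ 1`
`(L^k/|x₁ − x₂|_T)^θ·‖u(Γ)ψ(x₂) − ψ(x₁)‖ ≤ (L^kε)²·(κX + 2Y)` — telescoping `u(Γ)ψ(x₂) − ψ(x₁) = ε·Σ_m(±u(…))D_uψ(c_m)` (p29's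
`norm_transport_sub_le_sum_covD`), `(L^k/T)^θ ≤ L^k/T` for `T ≤ L^k`, `n·ε ≤ κT·ε`; resp. `(L^k/T)^θ ≤ 1`, `|u(Γ)| = 1`.
[cite: Balaban1983RegularityDecay, (1.9) p.573, mechanism] -/
theorem weighted_transport_sub_le {k : ℕ} (U : GaugeField P 0 U1) (ψ : Balaban1983to89.Site P 0 → ℂ) {θ κ X Y : ℝ}
    (hθ0 : 0 ≤ θ) (hθ1 : θ ≤ 1) (hκ : 0 ≤ κ) (hX : 0 ≤ X) (hY : 0 ≤ Y)
    {x₁ x₂ : Balaban1983to89.Site P 0} {n : ℕ} {sq : ℕ → Balaban1983to89.Site P 0} {cb : ℕ → PBond P 0}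
    (hsq0 : sq 0 = x₁) (hsqn : sq n = x₂) (hJ : ∀ m < n, Joins (cb m) (sq m) (sq (m + 1)))
    (hnle : (n : ℝ) ≤ κ * B5Ineq137Torus.T P 0 x₁ x₂)
    (hbond : B5Ineq137Torus.T P 0 x₁ x₂ ≤ (P.L : ℝ) ^ k → ∀ m < n, ‖covD P.eps⁻¹ (cfg U) ψ (cb m)‖ ≤ P.spacing k * X)
    (hval : (P.L : ℝ) ^ k < B5Ineq137Torus.T P 0 x₁ x₂ → ‖ψ x₁‖ ≤ P.spacing k ^ 2 * Y ∧ ‖ψ x₂‖ ≤ P.spacing k ^ 2 * Y) :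
    ((P.L : ℝ) ^ k / B5Ineq137Torus.T P 0 x₁ x₂) ^ θ * ‖toC (chainHol sq cb U n) * ψ x₂ - ψ x₁‖ ≤
      P.spacing k ^ 2 * (κ * X + 2 * Y) := by
  have hLk : (0 : ℝ) < (P.L : ℝ) ^ k := pow_pos P.cast_L_pos _
  have heps : 0 < P.eps := P.eps_pos
  have hsp0 : 0 < P.spacing k := P.spacing_pos k
  set T12 : ℝ := B5Ineq137Torus.T P 0 x₁ x₂ with hT12def
  have hT0 : 0 ≤ T12 := B5Ineq137Torus.T_nonneg P 0 x₁ x₂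
  set w : ℝ := ((P.L : ℝ) ^ k / T12) ^ θ with hwdef
  have hw0 : 0 ≤ w := Real.rpow_nonneg (div_nonneg hLk.le hT0) θ
  by_cases hnear : T12 ≤ (P.L : ℝ) ^ k
  · -- NEAR PAIRS: telescoping along the contour
    have hb := hbond hnear
    have htel := norm_transport_sub_le_sum_covD U (inv_ne_zero heps.ne') ψ sq cb n hJ
    rw [hsq0, hsqn, abs_inv, abs_of_pos heps, inv_inv] at htel
    have hsum : ∑ m' ∈ Finset.range n, ‖covD P.eps⁻¹ (cfg U) ψ (cb m')‖ ≤ n * (P.spacing k * X) := by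
      calc ∑ m' ∈ Finset.range n, ‖covD P.eps⁻¹ (cfg U) ψ (cb m')‖ ≤ ∑ _m' ∈ Finset.range n, P.spacing k * X :=
            Finset.sum_le_sum fun m' hm' => hb m' (Finset.mem_range.1 hm')
        _ = n * (P.spacing k * X) := by rw [Finset.sum_const, Finset.card_range, nsmul_eq_mul]
    have hdiff : ‖toC (chainHol sq cb U n) * ψ x₂ - ψ x₁‖ ≤ P.eps * (n * (P.spacing k * X)) :=
      htel.trans (mul_le_mul_of_nonneg_left hsum heps.le)
    have hwT : w * (P.eps * (n * (P.spacing k * X))) ≤ κ * (P.eps * (P.L : ℝ) ^ k) * (P.spacing k * X) := by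
      rcases hT0.eq_or_lt with hT00 | hTpos
      · have hn0 : (n : ℝ) = 0 := le_antisymm (by rw [← hT00, mul_zero] at hnle; exact hnle) (Nat.cast_nonneg n)
        rw [hn0, zero_mul, mul_zero, mul_zero]
        positivity
      · have hq : 1 ≤ (P.L : ℝ) ^ k / T12 := by rw [le_div_iff₀ hTpos, one_mul]; exact hnear
        have hw1 : w ≤ (P.L : ℝ) ^ k / T12 := rpow_le_self_of_one_le hq hθ1
        calc w * (P.eps * (n * (P.spacing k * X))) ≤ (P.L : ℝ) ^ k / T12 * (P.eps * ((κ * T12) * (P.spacing k * X))) :=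
              mul_le_mul hw1 (mul_le_mul_of_nonneg_left (mul_le_mul_of_nonneg_right hnle (by positivity)) heps.le) (by positivity)
                (div_nonneg hLk.le hT0)
          _ = κ * (P.eps * (P.L : ℝ) ^ k) * (P.spacing k * X) := by
              rw [div_mul_eq_mul_div, div_eq_iff hTpos.ne']
              ring
    have hspacing : P.eps * (P.L : ℝ) ^ k = P.spacing k := by rw [Params.spacing]; ring
    calc w * ‖toC (chainHol sq cb U n) * ψ x₂ - ψ x₁‖ ≤ w * (P.eps * (n * (P.spacing k * X))) := mul_le_mul_of_nonneg_left hdiff hw0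
      _ ≤ κ * (P.eps * (P.L : ℝ) ^ k) * (P.spacing k * X) := hwT
      _ = P.spacing k ^ 2 * (κ * X) := by rw [hspacing]; ring
      _ ≤ P.spacing k ^ 2 * (κ * X + 2 * Y) := mul_le_mul_of_nonneg_left (le_add_of_nonneg_right (by positivity)) (sq_nonneg _)
  · -- FAR PAIRS: the two end-point values, `|u(Γ)| = 1`
    push Not at hnear
    have hTpos : 0 < T12 := hLk.trans hnear
    have hw1 : w ≤ 1 := by
      refine Real.rpow_le_one (div_nonneg hLk.le hT0) ?_ hθ0
      rw [div_le_one hTpos]; exact hnear.le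
    obtain ⟨h1, h2⟩ := hval hnear
    have hsub : ‖toC (chainHol sq cb U n) * ψ x₂ - ψ x₁‖ ≤ P.spacing k ^ 2 * Y + P.spacing k ^ 2 * Y := by
      refine (norm_sub_le _ _).trans (add_le_add ?_ h1)
      rw [norm_mul, norm_toC, one_mul]; exact h2
    calc w * ‖toC (chainHol sq cb U n) * ψ x₂ - ψ x₁‖ ≤ ‖toC (chainHol sq cb U n) * ψ x₂ - ψ x₁‖ :=
          mul_le_of_le_one_left (norm_nonneg _) hw1
      _ ≤ P.spacing k ^ 2 * Y + P.spacing k ^ 2 * Y := hsub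
      _ = P.spacing k ^ 2 * (2 * Y) := by ring
      _ ≤ P.spacing k ^ 2 * (κ * X + 2 * Y) := mul_le_mul_of_nonneg_left (le_add_of_nonneg_left (by positivity)) (sq_nonneg _)

/-! ## §2 The value member of (2.31), `Ω = T_η`, from (H2) and (H4) -/

/-- kernel: a deeper chart margin implies a shallower one (r18's private `depth_mono`, re-proved). [folklore] -/
private theorem depth_mono (hPd : P.d = d + 1) {n : ℕ} {c M0 : Fin (d + 1) → ℕ} {D D' : ℝ} (hDD : D ≤ D') {x : Balaban1983to89.Site P 0}
    (hdeep : ∀ i, D' ≤ (boxCoord hPd n c x i : ℝ) ∧ (boxCoord hPd n c x i : ℝ) + D' ≤ (n * M0 i : ℕ) - 1) :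
    ∀ i, D ≤ (boxCoord hPd n c x i : ℝ) ∧ (boxCoord hPd n c x i : ℝ) + D ≤ (n * M0 i : ℕ) - 1 :=
  fun i => ⟨hDD.trans (hdeep i).1, by linarith [(hdeep i).2]⟩

set_option maxHeartbeats 400000 in
/-- **(2.31) WITH `Ω = T_η`, OPERATOR FORM, FOR THE PRINTED LOCALIZATION DATA, AT AN ARBITRARY `U(1)` FIELD, FROM THE TWO VALUE [6]-INPUTS
AS HYPOTHESES** (*"|(G_{k,loc}(u)f − G_k(Ω,u)f)(x)| ≦ e^{−cr(e_k)}e^{−c dist(suppt f,x)}‖f‖_∞, (2.31) for dist(x, Ω^c) ≧ O(r(e_k))"*):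
for every volume (`P.d = d+1`), `a`, `1 ≤ k ≤ K_P`, field `u`, `δ₀ > 0`, `ρ ≥ 0`, GIVEN (H2) the (1.11)–(1.12) value closeness
`|(G_k(□,u)g)(x) − (G_k(T_η,u)g)(x)| ≤ (L^kε)²c₀e^{−δ₀D/L^k}e^{−δ₀(D_b+D_f)/L^k}‖g‖_∞` for every fitting no-wrap cube `□`, every `ρ`-deep row
`x ∈ □` and every `g` supported in `□`, and (H4) the (1.10) value member `|(G_k(T_η,u)g)(x)| ≤ (L^kε)²c₀e^{−δ₀D/L^k}‖g‖_∞`; THEN for the data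
of record (torus gap `≥ R ≥ ρ`, `s ≥ 1`, `W ≥ 2s/3 + R₀/2 + R`, `0 ≤ R₁ < R₀`, cut-off `cutoff R₁ R₀ |·|_T`), every `x ∈ Ω₀` at chart depth
`≥ R₀ + R` and every `f` (`‖f‖_∞ ≤ F`) supported at sup-torus distance `≥ D ≥ 0` from `x`:
`|(G_{k,loc}(u)f)(x) − (G_k(T_η,u)f)(x)| ≤ (L^kε)²·c₀·[m·e^{−2δ₀R/L^k} + e^{−(δ₀/2)R₁/L^k}]·e^{−(δ₀/2)D/L^k}·F`, `m = (⌊(L^k−1+R₀)/s⌋+3)^{d+1}`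
— p31's generic `opClose231_gen` with `X₀ = T`, `X_α` = the `ρ`-deep rows of `□_α`, r18's `rowHyp_ii_torus`, p29's `rowHyp_i`/`rowHyp_iii`
and multiplicity `card_subtype_activeLabels_le`.
[cite: BalabanImbrieJaffe1988, (2.31) p.263] [cite: Balaban1983RegularityDecay, Theorem p.573 (1.10)–(1.12)] -/
theorem close231_wholeTorus_of_inputs (d : ℕ) {c₀ : ℝ} (hc₀ : 0 ≤ c₀) :
    ∀ (P : Params) (hPd : P.d = d + 1) (a : ℝ) (k : ℕ), 1 ≤ k → k ≤ P.K →
      ∀ (U : GaugeField P 0 U1) (δ₀ ρ : ℝ), 0 < δ₀ → 0 ≤ ρ →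
      -- (H2) the (1.11)–(1.12) value closeness member for the fitting no-wrap cubes `□ ⊂ T_η`
      (∀ (c' M' : Fin (d + 1) → ℕ), (∀ i, 1 ≤ M' i) → (∀ i, c' i * P.L ^ k + P.L ^ k * M' i ≤ P.sitesPerDir 0) →
          (∀ i, P.L ^ k * M' i < P.sitesPerDir 0) →
        ∀ (x : Balaban1983to89.Site P 0), x ∈ (cubeT hPd (P.L ^ k) c' fun i => P.L ^ k * M' i) →
          (∀ w, w ∉ (cubeT hPd (P.L ^ k) c' fun i => P.L ^ k * M' i) → ρ ≤ B5Ineq137Torus.T P 0 x w) →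
        ∀ (g : Balaban1983to89.Site P 0 → ℂ) (F D Db Df : ℝ), (∀ y, ‖g y‖ ≤ F) →
          (∀ y, y ∉ (cubeT hPd (P.L ^ k) c' fun i => P.L ^ k * M' i) → g y = 0) →
          0 ≤ D → (∀ y, g y ≠ 0 → D ≤ B5Ineq137Torus.T P 0 x y) →
          0 ≤ Db → (∀ w, w ∉ (cubeT hPd (P.L ^ k) c' fun i => P.L ^ k * M' i) → Db ≤ B5Ineq137Torus.T P 0 x w) →
          0 ≤ Df → (∀ y, g y ≠ 0 → ∀ w, w ∉ (cubeT hPd (P.L ^ k) c' fun i => P.L ^ k * M' i) → Df ≤ B5Ineq137Torus.T P 0 y w) →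
          ‖(gBox (B1RG242Torus.α P a k * (P.L : ℝ) ^ (k * P.d)) P.eps⁻¹ U k (cubeT hPd (P.L ^ k) c' fun i => P.L ^ k * M' i) *ᵥ g) x -
              (gBox (B1RG242Torus.α P a k * (P.L : ℝ) ^ (k * P.d)) P.eps⁻¹ U k univ *ᵥ g) x‖ ≤
            P.spacing k ^ 2 * (c₀ * Real.exp (-(δ₀ * (((P.L : ℝ) ^ k)⁻¹ * D))) * Real.exp (-(δ₀ * (((P.L : ℝ) ^ k)⁻¹ * (Db + Df)))) * F)) →
      -- (H4) the (1.10) value member of `G_k(T_η,u)`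
      (∀ (x : Balaban1983to89.Site P 0) (g : Balaban1983to89.Site P 0 → ℂ) (F D : ℝ), (∀ y, ‖g y‖ ≤ F) → 0 ≤ D →
          (∀ y, g y ≠ 0 → D ≤ B5Ineq137Torus.T P 0 x y) →
          ‖(gBox (B1RG242Torus.α P a k * (P.L : ℝ) ^ (k * P.d)) P.eps⁻¹ U k univ *ᵥ g) x‖ ≤
            P.spacing k ^ 2 * (c₀ * Real.exp (-(δ₀ * (((P.L : ℝ) ^ k)⁻¹ * D))) * F)) →
      ∀ (c M0 : Fin (d + 1) → ℕ), (∀ i, 1 ≤ M0 i) →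
        (∀ i, c i * P.L ^ k + P.L ^ k * M0 i ≤ P.sitesPerDir 0) → (∀ i, P.L ^ k * M0 i < P.sitesPerDir 0) →
      ∀ (s W : ℕ), 1 ≤ s → ∀ (R R₀ R₁ : ℝ), ρ ≤ R → 0 ≤ R₁ → R₁ < R₀ → 2 * (s : ℝ) / 3 + R₀ / 2 + R ≤ W →
        (∀ i, ((P.L ^ k * M0 i : ℕ) : ℝ) + R ≤ P.sitesPerDir 0) →
      ∀ (x : Balaban1983to89.Site P 0), x ∈ (cubeT hPd (P.L ^ k) c fun i => P.L ^ k * M0 i) →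
        (∀ i, R₀ + R ≤ (boxCoord hPd (P.L ^ k) c x i : ℝ) ∧ (boxCoord hPd (P.L ^ k) c x i : ℝ) + (R₀ + R) ≤ (P.L ^ k * M0 i : ℕ) - 1) →
      ∀ (f : Balaban1983to89.Site P 0 → ℂ) (F D : ℝ), (∀ y, ‖f y‖ ≤ F) → 0 ≤ D → (∀ y, f y ≠ 0 → D ≤ B5Ineq137Torus.T P 0 x y) →
        ‖(gLocT (B1RG242Torus.α P a k * (P.L : ℝ) ^ (k * P.d)) P.eps⁻¹ U k
                (cubeFam hPd (P.L ^ k) c M0 s W) (lamFam hPd (P.L ^ k) c M0 s) (cutoff R₁ R₀ (B5Ineq137Torus.T P 0)) *ᵥ f) x -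
            (gBox (B1RG242Torus.α P a k * (P.L : ℝ) ^ (k * P.d)) P.eps⁻¹ U k univ *ᵥ f) x‖ ≤
          P.spacing k ^ 2 * (c₀ * ((⌊(((P.L : ℝ) ^ k) - 1 + R₀) / s⌋₊ + 3) ^ (d + 1) * Real.exp (-(δ₀ * (((P.L : ℝ) ^ k)⁻¹ * (2 * R)))) +
              Real.exp (-(δ₀ / 2 * (((P.L : ℝ) ^ k)⁻¹ * R₁)))) *
            Real.exp (-(δ₀ / 2 * (((P.L : ℝ) ^ k)⁻¹ * D))) * F) := by
  intro P hPd a k _hk1 hkK U δ₀ ρ hδ₀ hρ H2 H4 c M0 hM0 hfit0 hN0 s W hs R R₀ R₁ hρR hR₁ hR10 hW hgap x hx hdeep f F D hF hD hsupp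
  classical
  have hn : 1 ≤ P.L ^ k := Nat.one_le_pow _ _ P.L_pos
  have hk : 0 + k ≤ P.m + P.K := by omega
  have hR0 : 0 ≤ R := hρ.trans hρR
  have hR₀ : 0 ≤ R₀ := hR₁.trans hR10.le
  have hs0 : 0 < s := hs
  have hF0 : 0 ≤ F := (norm_nonneg _).trans (hF x)
  have hζ0 := cutoff_eq_zero_of_le (P := P) hR10
  have hdeep₀ := depth_mono hPd (show R₀ ≤ R₀ + R by linarith) hdeep
  set A : ℝ := B1RG242Torus.α P a k * (P.L : ℝ) ^ (k * P.d) with hAdef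
  set ζ := cutoff R₁ R₀ (B5Ineq137Torus.T P 0) with hζdef
  set m : ℝ := ((⌊(((P.L : ℝ) ^ k) - 1 + R₀) / s⌋₊ : ℝ) + 3) ^ (d + 1) with hmdef
  -- the row sets of (H2): the `ρ`-deep rows of each cube
  set Xr : ↥(labels (P.L ^ k) M0 s) → Finset (Balaban1983to89.Site P 0) := fun α =>
    (cubeFam hPd (P.L ^ k) c M0 s W α).filter fun z => ∀ w, w ∉ cubeFam hPd (P.L ^ k) c M0 s W α → ρ ≤ B5Ineq137Torus.T P 0 z w
    with hXrdef
  -- the active labels on the row of `x`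
  set S : Finset ↥(labels (P.L ^ k) M0 s) :=
    (activeLabels hPd (P.L ^ k) c s R₀ (blkIter k x)).subtype fun α => α ∈ labels (P.L ^ k) M0 s with hSdef
  have hcardS : (S.card : ℝ) ≤ m := by
    have h1 := card_subtype_activeLabels_le (hPd := hPd) (c := c) (M0 := M0) hn hs0 hR₀ (blkIter k x)
    have e : (((P.L ^ k : ℕ) : ℕ) : ℝ) = (P.L : ℝ) ^ k := by push_cast; rfl
    rw [hSdef, hmdef]; rw [e] at h1; exact h1
  have hS : ∀ (α : ↥(labels (P.L ^ k) M0 s)) (y : Balaban1983to89.Site P 0), ζ x y * lamFam hPd (P.L ^ k) c M0 s α x y ≠ 0 →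
      f y ≠ 0 → α ∈ S := by
    intro α y hne _
    rw [hSdef, Finset.mem_subtype]
    exact mem_activeLabels_of_ne_zero_of_deep hk hs0 hfit0 hζ0 (mem_blockK.2 rfl) hdeep₀ hne
  have hGΩ : ∀ z ∈ (univ : Finset (Balaban1983to89.Site P 0)), ∀ (g : Balaban1983to89.Site P 0 → ℂ) (F D : ℝ), (∀ y, ‖g y‖ ≤ F) →
      0 ≤ D → (∀ y, g y ≠ 0 → D ≤ B5Ineq137Torus.T P 0 z y) →
      ‖(gBox A P.eps⁻¹ U k univ *ᵥ g) z‖ ≤ P.spacing k ^ 2 * (c₀ * Real.exp (-(δ₀ * (((P.L : ℝ) ^ k)⁻¹ * D))) * F) :=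
    fun z _ g F D hF hD hs => H4 z g F D hF hD hs
  have hC : ∀ α, ∀ z ∈ Xr α, ∀ (g : Balaban1983to89.Site P 0 → ℂ) (F D Db Df : ℝ), (∀ y, ‖g y‖ ≤ F) →
      (∀ y, y ∉ cubeFam hPd (P.L ^ k) c M0 s W α → g y = 0) →
      0 ≤ D → (∀ y, g y ≠ 0 → D ≤ B5Ineq137Torus.T P 0 z y) → 0 ≤ Db →
      (∀ w, w ∉ cubeFam hPd (P.L ^ k) c M0 s W α → Db ≤ B5Ineq137Torus.T P 0 z w) →
      0 ≤ Df → (∀ y, g y ≠ 0 → ∀ w, w ∉ cubeFam hPd (P.L ^ k) c M0 s W α → Df ≤ B5Ineq137Torus.T P 0 y w) →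
      ‖(gBox A P.eps⁻¹ U k (cubeFam hPd (P.L ^ k) c M0 s W α) *ᵥ g) z - (gBox A P.eps⁻¹ U k univ *ᵥ g) z‖ ≤
        P.spacing k ^ 2 * (c₀ * Real.exp (-(δ₀ * (((P.L : ℝ) ^ k)⁻¹ * D))) * Real.exp (-(δ₀ * (((P.L : ℝ) ^ k)⁻¹ * (Db + Df)))) * F) := by
    intro α z hz g F' D' Db Df hF' hsuppg hD' hsD' hDb hsDb hDf hsDf
    obtain ⟨c', M', hM', hfit', hN', hcα⟩ := cubeFam_fits (hPd := hPd) (n := P.L ^ k) (c := c) (s := s) (W := W) hM0 hfit0 hN0 α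
    simp only [hXrdef, Finset.mem_filter] at hz
    obtain ⟨hz1, hz2⟩ := hz
    rw [hcα] at hz1 hz2 hsuppg hsDb hsDf ⊢
    exact H2 c' M' hM' hfit' hN' z hz1 hz2 g F' D' Db Df hF' hsuppg hD' hsD' hDb hsDb hDf hsDf
  have hcomp : ∀ y, ζ x y ≠ 0 → ∑ α : ↥(labels (P.L ^ k) M0 s), lamFam hPd (P.L ^ k) c M0 s α x y = 1 :=
    rowHyp_i hPd hfit0 hζ0 hx hdeep₀
  have hdeepH : ∀ (α : ↥(labels (P.L ^ k) M0 s)) (y : Balaban1983to89.Site P 0), ζ x y * lamFam hPd (P.L ^ k) c M0 s α x y ≠ 0 →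
      x ∈ Xr α ∧ y ∈ cubeFam hPd (P.L ^ k) c M0 s W α ∧
        ∀ w, w ∉ cubeFam hPd (P.L ^ k) c M0 s W α → R ≤ B5Ineq137Torus.T P 0 x w ∧ R ≤ B5Ineq137Torus.T P 0 y w := by
    intro α y hne
    obtain ⟨hxα, hyα, hfar⟩ := rowHyp_ii_torus hPd hn hs0 hfit0 hR0 hR₀ hgap hW hζ0 hx hdeep α y hne
    refine ⟨?_, hyα, hfar⟩
    simp only [hXrdef, Finset.mem_filter]
    exact ⟨hxα, fun w hw => hρR.trans (hfar w hw).1⟩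
  have hcut : ∀ y, B5Ineq137Torus.T P 0 x y ≤ R₁ → ζ x y = 1 := rowHyp_iii hR10 x
  have hmain := opClose231_gen A P.eps⁻¹ U univ univ (cubeFam hPd (P.L ^ k) c M0 s W) Xr (sum_abs_lamT_le_one hfit0)
    (cutoff_mem_unitInterval R₁ R₀) hδ₀.le hc₀ hGΩ hC x (Finset.mem_univ x) hR0 hcomp hdeepH hcut f hF hD hsupp S hS
  refine hmain.trans (mul_le_mul_of_nonneg_left ?_ (sq_nonneg _))
  refine mul_le_mul_of_nonneg_right (mul_le_mul_of_nonneg_right (mul_le_mul_of_nonneg_left ?_ hc₀) (Real.exp_pos _).le) hF0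
  exact add_le_add (mul_le_mul_of_nonneg_right hcardS (Real.exp_pos _).le) le_rfl

/-! ## §3 The Hölder member of order `θ ≤ 1` of (2.31), `Ω = T_η`, from (H1)–(H4), along admissible contours -/

/-- kernel: the covariant derivative is additive in the function: `D_u(φ − ψ) = D_uφ − D_uψ`. [cite: BalabanImbrieJaffe1988, (3.3) p.265] -/
private theorem covD_sub {j : ℕ} (c' : ℝ) (u : PBond P j → ℂ) (φ ψ : Balaban1983to89.Site P j → ℂ) (b : PBond P j) :
    covD c' u (φ - ψ) b = covD c' u φ b - covD c' u ψ b := by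
  simp only [covD, Pi.sub_apply]; ring

set_option maxHeartbeats 400000 in
/-- **THE HÖLDER MEMBER OF ORDER `θ ≤ 1` OF (2.31) WITH `Ω = T_η` FOR THE PRINTED LOCALIZATION DATA, AT AN ARBITRARY `U(1)` FIELD, FROM THE
FOUR [6]-INPUTS AS HYPOTHESES, ALONG EVERY ADMISSIBLE CONTOUR** (p. 263: *"Bounds analogous to (2.30), (2.31) hold for covariant derivatives
and Hölder derivatives of G_{k,loc}(u) of order less than two"*; [6] (1.9)'s form `(L^k/|x − x′|)^θ|U(A(Γ_{x,x′}))φ(x′) − φ(x)|`).  THERE IS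
`C > 0` (from `d, c₀` and p13's cut-off modulus) such that, with the hypotheses (H1)–(H4) and the data of `deriv231_wholeTorus_of_inputs`, for
EVERY exponent `0 ≤ θ ≤ 1`, every pair `x₁, x₂` joined by a bond chain `Γ = (x₁ = s_0, …, s_n = x₂)` of `n ≤ (d+1)|x₁ − x₂|_T` steps all of
whose sites lie in `Ω₀` at chart depth `≥ R₀ + R` and within sup-torus distance `|x₁ − x₂|_T` of `x₁`, and every `f` (`‖f‖_∞ ≤ F`) supported at
sup-torus distance `≥ D ≥ 0` from `x₁` and from `x₂`: with `ψ = G_{k,loc}(u)f − G_k(T_η,u)f` and `u(Γ) = Π_m u(c_m)^{±1}` (T4's `chainHol`),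
`(L^k/|x₁ − x₂|_T)^θ·‖u(Γ)ψ(x₂) − ψ(x₁)‖ ≤
 (L^kε)²·C·e^{δ₀/2}·[m(1 + L^k((R₀−R₁)⁻¹ + s⁻¹))e^{−δ₀(2R−1)/L^k} + (1 + L^k(R₀−R₁)⁻¹)e^{−(δ₀/2)(R₁−1)/L^k}]·e^{−(δ₀/2)D/L^k}·F`
— §1's kernel with NEAR PAIRS (`|x₁ − x₂|_T ≤ L^k`): `deriv231_wholeTorus_of_inputs` on every bond of `Γ` (support distance `≥ D − L^k`,
whence the factor `e^{δ₀/2}`); FAR PAIRS: §2's value member at both end points (its bracket is dominated by the derivative member's).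
[cite: BalabanImbrieJaffe1988, (2.31) p.263] [cite: Balaban1983RegularityDecay, Theorem p.573 (1.9)–(1.12)] -/
theorem holder231_wholeTorus_of_inputs (d : ℕ) {c₀ : ℝ} (hc₀ : 0 ≤ c₀) :
    ∃ C : ℝ, 0 < C ∧ ∀ (P : Params) (hPd : P.d = d + 1) (a : ℝ) (k : ℕ), 1 ≤ k → k ≤ P.K →
      ∀ (U : GaugeField P 0 U1) (δ₀ ρ : ℝ), 0 < δ₀ → 0 ≤ ρ →
      -- (H1) the (1.11)–(1.12) covariant-derivative closeness member for the fitting no-wrap cubes `□ ⊂ T_η`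
      (∀ (c' M' : Fin (d + 1) → ℕ), (∀ i, 1 ≤ M' i) → (∀ i, c' i * P.L ^ k + P.L ^ k * M' i ≤ P.sitesPerDir 0) →
          (∀ i, P.L ^ k * M' i < P.sitesPerDir 0) →
        ∀ (x : Balaban1983to89.Site P 0) (μ : Fin P.d), x ∈ (cubeT hPd (P.L ^ k) c' fun i => P.L ^ k * M' i) →
          x.shift μ ∈ (cubeT hPd (P.L ^ k) c' fun i => P.L ^ k * M' i) →
          (∀ w, w ∉ (cubeT hPd (P.L ^ k) c' fun i => P.L ^ k * M' i) → ρ ≤ B5Ineq137Torus.T P 0 x w) →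
        ∀ (g : Balaban1983to89.Site P 0 → ℂ) (F D Db Df : ℝ), (∀ y, ‖g y‖ ≤ F) →
          (∀ y, y ∉ (cubeT hPd (P.L ^ k) c' fun i => P.L ^ k * M' i) → g y = 0) →
          0 ≤ D → (∀ y, g y ≠ 0 → D ≤ B5Ineq137Torus.T P 0 x y) →
          0 ≤ Db → (∀ w, w ∉ (cubeT hPd (P.L ^ k) c' fun i => P.L ^ k * M' i) → Db ≤ B5Ineq137Torus.T P 0 x w) →
          0 ≤ Df → (∀ y, g y ≠ 0 → ∀ w, w ∉ (cubeT hPd (P.L ^ k) c' fun i => P.L ^ k * M' i) → Df ≤ B5Ineq137Torus.T P 0 y w) →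
          ‖covD P.eps⁻¹ (cfg U) (gBox (B1RG242Torus.α P a k * (P.L : ℝ) ^ (k * P.d)) P.eps⁻¹ U k
                  (cubeT hPd (P.L ^ k) c' fun i => P.L ^ k * M' i) *ᵥ g) ⟨x, μ⟩ -
              covD P.eps⁻¹ (cfg U) (gBox (B1RG242Torus.α P a k * (P.L : ℝ) ^ (k * P.d)) P.eps⁻¹ U k univ *ᵥ g) ⟨x, μ⟩‖ ≤
            P.spacing k * (c₀ * Real.exp (-(δ₀ * (((P.L : ℝ) ^ k)⁻¹ * D))) * Real.exp (-(δ₀ * (((P.L : ℝ) ^ k)⁻¹ * (Db + Df)))) * F)) →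
      -- (H2) the (1.11)–(1.12) value closeness member for the same cubes and rows
      (∀ (c' M' : Fin (d + 1) → ℕ), (∀ i, 1 ≤ M' i) → (∀ i, c' i * P.L ^ k + P.L ^ k * M' i ≤ P.sitesPerDir 0) →
          (∀ i, P.L ^ k * M' i < P.sitesPerDir 0) →
        ∀ (x : Balaban1983to89.Site P 0), x ∈ (cubeT hPd (P.L ^ k) c' fun i => P.L ^ k * M' i) →
          (∀ w, w ∉ (cubeT hPd (P.L ^ k) c' fun i => P.L ^ k * M' i) → ρ ≤ B5Ineq137Torus.T P 0 x w) →
        ∀ (g : Balaban1983to89.Site P 0 → ℂ) (F D Db Df : ℝ), (∀ y, ‖g y‖ ≤ F) →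
          (∀ y, y ∉ (cubeT hPd (P.L ^ k) c' fun i => P.L ^ k * M' i) → g y = 0) →
          0 ≤ D → (∀ y, g y ≠ 0 → D ≤ B5Ineq137Torus.T P 0 x y) →
          0 ≤ Db → (∀ w, w ∉ (cubeT hPd (P.L ^ k) c' fun i => P.L ^ k * M' i) → Db ≤ B5Ineq137Torus.T P 0 x w) →
          0 ≤ Df → (∀ y, g y ≠ 0 → ∀ w, w ∉ (cubeT hPd (P.L ^ k) c' fun i => P.L ^ k * M' i) → Df ≤ B5Ineq137Torus.T P 0 y w) →
          ‖(gBox (B1RG242Torus.α P a k * (P.L : ℝ) ^ (k * P.d)) P.eps⁻¹ U k (cubeT hPd (P.L ^ k) c' fun i => P.L ^ k * M' i) *ᵥ g) x -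
              (gBox (B1RG242Torus.α P a k * (P.L : ℝ) ^ (k * P.d)) P.eps⁻¹ U k univ *ᵥ g) x‖ ≤
            P.spacing k ^ 2 * (c₀ * Real.exp (-(δ₀ * (((P.L : ℝ) ^ k)⁻¹ * D))) * Real.exp (-(δ₀ * (((P.L : ℝ) ^ k)⁻¹ * (Db + Df)))) * F)) →
      -- (H3) the (1.10) covariant-derivative member of `G_k(T_η,u)`
      (∀ (x : Balaban1983to89.Site P 0) (μ : Fin P.d) (g : Balaban1983to89.Site P 0 → ℂ) (F D : ℝ), (∀ y, ‖g y‖ ≤ F) → 0 ≤ D →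
          (∀ y, g y ≠ 0 → D ≤ B5Ineq137Torus.T P 0 x y) →
          ‖covD P.eps⁻¹ (cfg U) (gBox (B1RG242Torus.α P a k * (P.L : ℝ) ^ (k * P.d)) P.eps⁻¹ U k univ *ᵥ g) ⟨x, μ⟩‖ ≤
            P.spacing k * (c₀ * Real.exp (-(δ₀ * (((P.L : ℝ) ^ k)⁻¹ * D))) * F)) →
      -- (H4) the (1.10) value member of `G_k(T_η,u)`
      (∀ (x : Balaban1983to89.Site P 0) (g : Balaban1983to89.Site P 0 → ℂ) (F D : ℝ), (∀ y, ‖g y‖ ≤ F) → 0 ≤ D →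
          (∀ y, g y ≠ 0 → D ≤ B5Ineq137Torus.T P 0 x y) →
          ‖(gBox (B1RG242Torus.α P a k * (P.L : ℝ) ^ (k * P.d)) P.eps⁻¹ U k univ *ᵥ g) x‖ ≤
            P.spacing k ^ 2 * (c₀ * Real.exp (-(δ₀ * (((P.L : ℝ) ^ k)⁻¹ * D))) * F)) →
      ∀ (c M0 : Fin (d + 1) → ℕ), (∀ i, 1 ≤ M0 i) →
        (∀ i, c i * P.L ^ k + P.L ^ k * M0 i ≤ P.sitesPerDir 0) → (∀ i, P.L ^ k * M0 i < P.sitesPerDir 0) →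
      ∀ (s W : ℕ), 1 ≤ s → ∀ (R R₀ R₁ : ℝ), ρ + 1 < R → 0 ≤ R₁ → R₁ < R₀ → 2 * (s : ℝ) / 3 + R₀ / 2 + R ≤ W →
        (∀ i, ((P.L ^ k * M0 i : ℕ) : ℝ) + R ≤ P.sitesPerDir 0) →
      ∀ (θ : ℝ), 0 ≤ θ → θ ≤ 1 →
      ∀ (x₁ x₂ : Balaban1983to89.Site P 0) (n : ℕ) (sq : ℕ → Balaban1983to89.Site P 0) (cb : ℕ → PBond P 0),
        sq 0 = x₁ → sq n = x₂ → (∀ m < n, Joins (cb m) (sq m) (sq (m + 1))) →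
        (n : ℝ) ≤ ((d : ℝ) + 1) * B5Ineq137Torus.T P 0 x₁ x₂ →
        (∀ m ≤ n, sq m ∈ (cubeT hPd (P.L ^ k) c fun i => P.L ^ k * M0 i) ∧
          (∀ i, R₀ + R ≤ (boxCoord hPd (P.L ^ k) c (sq m) i : ℝ) ∧
            (boxCoord hPd (P.L ^ k) c (sq m) i : ℝ) + (R₀ + R) ≤ (P.L ^ k * M0 i : ℕ) - 1) ∧
          B5Ineq137Torus.T P 0 x₁ (sq m) ≤ B5Ineq137Torus.T P 0 x₁ x₂) →
      ∀ (f : Balaban1983to89.Site P 0 → ℂ) (F D : ℝ), (∀ y, ‖f y‖ ≤ F) → 0 ≤ D →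
        (∀ y, f y ≠ 0 → D ≤ B5Ineq137Torus.T P 0 x₁ y) → (∀ y, f y ≠ 0 → D ≤ B5Ineq137Torus.T P 0 x₂ y) →
        ((P.L : ℝ) ^ k / B5Ineq137Torus.T P 0 x₁ x₂) ^ θ *
          ‖toC (chainHol sq cb U n) *
              ((gLocT (B1RG242Torus.α P a k * (P.L : ℝ) ^ (k * P.d)) P.eps⁻¹ U k
                  (cubeFam hPd (P.L ^ k) c M0 s W) (lamFam hPd (P.L ^ k) c M0 s) (cutoff R₁ R₀ (B5Ineq137Torus.T P 0)) *ᵥ f) x₂ -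
                (gBox (B1RG242Torus.α P a k * (P.L : ℝ) ^ (k * P.d)) P.eps⁻¹ U k univ *ᵥ f) x₂) -
            ((gLocT (B1RG242Torus.α P a k * (P.L : ℝ) ^ (k * P.d)) P.eps⁻¹ U k
                  (cubeFam hPd (P.L ^ k) c M0 s W) (lamFam hPd (P.L ^ k) c M0 s) (cutoff R₁ R₀ (B5Ineq137Torus.T P 0)) *ᵥ f) x₁ -
                (gBox (B1RG242Torus.α P a k * (P.L : ℝ) ^ (k * P.d)) P.eps⁻¹ U k univ *ᵥ f) x₁)‖ ≤
          P.spacing k ^ 2 * (C * Real.exp (δ₀ / 2) *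
            ((⌊(((P.L : ℝ) ^ k) - 1 + R₀) / s⌋₊ + 3) ^ (d + 1) * (1 + (P.L : ℝ) ^ k * ((R₀ - R₁)⁻¹ + (s : ℝ)⁻¹)) *
              Real.exp (-(δ₀ * (((P.L : ℝ) ^ k)⁻¹ * (2 * R - 1)))) +
            (1 + (P.L : ℝ) ^ k * (R₀ - R₁)⁻¹) * Real.exp (-(δ₀ / 2 * (((P.L : ℝ) ^ k)⁻¹ * (R₁ - 1))))) *
            Real.exp (-(δ₀ / 2 * (((P.L : ℝ) ^ k)⁻¹ * D))) * F) := by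
  obtain ⟨C₁, hC₁, G1⟩ := deriv231_wholeTorus_of_inputs d hc₀
  refine ⟨((d : ℝ) + 1) * C₁ + 2 * c₀, by positivity, ?_⟩
  intro P hPd a k hk1 hkK U δ₀ ρ hδ₀ hρ H1 H2 H3 H4 c M0 hM0 hfit0 hN0 s W hs R R₀ R₁ hR hR₁ hR10 hW hgap θ hθ0 hθ1
    x₁ x₂ n sq cb hsq0 hsqn hJ hnle hchain f F D hF hD hsupp₁ hsupp₂
  have hρR : ρ ≤ R := by linarith
  have G2 := close231_wholeTorus_of_inputs d hc₀ P hPd a k hk1 hkK U δ₀ ρ hδ₀ hρ H2 H4 c M0 hM0 hfit0 hN0 s W hs R R₀ R₁ hρR hR₁ hR10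
    hW hgap
  replace G1 := G1 P hPd a k hk1 hkK U δ₀ ρ hδ₀ hρ H1 H2 H3 H4 c M0 hM0 hfit0 hN0 s W hs R R₀ R₁ hR hR₁ hR10 hW hgap
  set C : ℝ := ((d : ℝ) + 1) * C₁ + 2 * c₀ with hCdef
  have hLpos : (0 : ℝ) < P.L := P.cast_L_pos
  have hLk : (0 : ℝ) < (P.L : ℝ) ^ k := pow_pos hLpos _
  have hLkinv : 0 < ((P.L : ℝ) ^ k)⁻¹ := inv_pos.mpr hLk
  have hF0 : 0 ≤ F := (norm_nonneg _).trans (hF x₁)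
  have hgap' : 0 < R₀ - R₁ := sub_pos.2 hR10
  have hsr : (0 : ℝ) < s := by exact_mod_cast hs
  have hT0 : 0 ≤ B5Ineq137Torus.T P 0 x₁ x₂ := B5Ineq137Torus.T_nonneg P 0 x₁ x₂
  -- the end points are chain sites
  obtain ⟨hx₁, hdeep₁, -⟩ := hsq0 ▸ hchain 0 (Nat.zero_le n)
  obtain ⟨hx₂, hdeep₂, -⟩ := hsqn ▸ hchain n le_rfl
  -- abbreviations
  set Aop : ℝ := B1RG242Torus.α P a k * (P.L : ℝ) ^ (k * P.d) with hAdef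
  set ζ := cutoff R₁ R₀ (B5Ineq137Torus.T P 0) with hζdef
  set ψL : Balaban1983to89.Site P 0 → ℂ := gLocT Aop P.eps⁻¹ U k (cubeFam hPd (P.L ^ k) c M0 s W) (lamFam hPd (P.L ^ k) c M0 s) ζ *ᵥ f
    with hψLdef
  set ψΩ : Balaban1983to89.Site P 0 → ℂ := gBox Aop P.eps⁻¹ U k univ *ᵥ f with hψΩdef
  set ψ : Balaban1983to89.Site P 0 → ℂ := ψL - ψΩ with hψdef
  have hψ : ∀ x, ψL x - ψΩ x = ψ x := fun x => rfl
  set T12 : ℝ := B5Ineq137Torus.T P 0 x₁ x₂ with hT12def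
  set m : ℝ := ((⌊(((P.L : ℝ) ^ k) - 1 + R₀) / s⌋₊ : ℝ) + 3) ^ (d + 1) with hmdef
  have hm0 : 0 ≤ m := by rw [hmdef]; positivity
  set br : ℝ := 1 + (P.L : ℝ) ^ k * ((R₀ - R₁)⁻¹ + (s : ℝ)⁻¹) with hbrdef
  have hbr1 : 1 ≤ br := by rw [hbrdef]; exact le_add_of_nonneg_right (by positivity)
  have hbr0 : 0 ≤ br := zero_le_one.trans hbr1
  set br₁ : ℝ := 1 + (P.L : ℝ) ^ k * (R₀ - R₁)⁻¹ with hbr₁def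
  have hbr₁1 : 1 ≤ br₁ := by rw [hbr₁def]; exact le_add_of_nonneg_right (by positivity)
  have hbr₁0 : 0 ≤ br₁ := zero_le_one.trans hbr₁1
  set ER : ℝ := Real.exp (-(δ₀ * (((P.L : ℝ) ^ k)⁻¹ * (2 * R - 1)))) with hERdef
  set ER₁ : ℝ := Real.exp (-(δ₀ / 2 * (((P.L : ℝ) ^ k)⁻¹ * (R₁ - 1)))) with hER₁def
  set Ex : ℝ := Real.exp (-(δ₀ / 2 * (((P.L : ℝ) ^ k)⁻¹ * D))) with hEdef
  have hER0 : 0 < ER := Real.exp_pos _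
  have hER₁0 : 0 < ER₁ := Real.exp_pos _
  have hE0 : 0 < Ex := Real.exp_pos _
  set Br : ℝ := m * br * ER + br₁ * ER₁ with hBrdef
  have hBr0 : 0 ≤ Br := by positivity
  have he1 : 1 ≤ Real.exp (δ₀ / 2) := Real.one_le_exp (by positivity)
  -- the value member's exponentials are dominated by the derivative member's
  have hER_2 : Real.exp (-(δ₀ * (((P.L : ℝ) ^ k)⁻¹ * (2 * R)))) ≤ ER :=
    Real.exp_le_exp.2 (neg_le_neg (mul_le_mul_of_nonneg_left (mul_le_mul_of_nonneg_left (by linarith) hLkinv.le) hδ₀.le))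
  have hER₁_2 : Real.exp (-(δ₀ / 2 * (((P.L : ℝ) ^ k)⁻¹ * R₁))) ≤ ER₁ :=
    Real.exp_le_exp.2 (neg_le_neg (mul_le_mul_of_nonneg_left (mul_le_mul_of_nonneg_left (by linarith) hLkinv.le) (by positivity)))
  show ((P.L : ℝ) ^ k / T12) ^ θ * ‖toC (chainHol sq cb U n) * (ψL x₂ - ψΩ x₂) - (ψL x₁ - ψΩ x₁)‖ ≤ _
  rw [hψ, hψ]
  -- the target, factorised
  have hRHS : P.spacing k ^ 2 * (C * Real.exp (δ₀ / 2) * Br * Ex * F) =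
      P.spacing k ^ 2 * (C * Real.exp (δ₀ / 2) *
        ((⌊(((P.L : ℝ) ^ k) - 1 + R₀) / s⌋₊ + 3) ^ (d + 1) * (1 + (P.L : ℝ) ^ k * ((R₀ - R₁)⁻¹ + (s : ℝ)⁻¹)) *
          Real.exp (-(δ₀ * (((P.L : ℝ) ^ k)⁻¹ * (2 * R - 1)))) +
        (1 + (P.L : ℝ) ^ k * (R₀ - R₁)⁻¹) * Real.exp (-(δ₀ / 2 * (((P.L : ℝ) ^ k)⁻¹ * (R₁ - 1))))) *
        Real.exp (-(δ₀ / 2 * (((P.L : ℝ) ^ k)⁻¹ * D))) * F) := by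
    rw [hBrdef, hmdef, hbrdef, hbr₁def, hERdef, hER₁def, hEdef]
  rw [← hRHS]
  -- the two quantities of §1's kernel
  set X : ℝ := C₁ * Real.exp (δ₀ / 2) * Br * Ex * F with hXdef
  set Y : ℝ := c₀ * Br * Ex * F with hYdef
  have hX0 : 0 ≤ X := by positivity
  have hY0 : 0 ≤ Y := by positivity
  -- NEAR PAIRS: the derivative member on every bond of the contour
  have hbond : T12 ≤ (P.L : ℝ) ^ k → ∀ m' < n, ‖covD P.eps⁻¹ (cfg U) ψ (cb m')‖ ≤ P.spacing k * X := by
    intro hnear m' hm'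
    obtain ⟨hmem0, hdeep0, hclose0⟩ := hchain m' hm'.le
    obtain ⟨hmem1, hdeep1, hclose1⟩ := hchain (m' + 1) (Nat.succ_le_of_lt hm')
    have hb : cb m' = ⟨(cb m').src, (cb m').dir⟩ := rfl
    have htgt : (cb m').tgt = (cb m').src.shift (cb m').dir := rfl
    have hends : ((cb m').src ∈ (cubeT hPd (P.L ^ k) c fun i => P.L ^ k * M0 i) ∧
        (∀ i, R₀ + R ≤ (boxCoord hPd (P.L ^ k) c (cb m').src i : ℝ) ∧
          (boxCoord hPd (P.L ^ k) c (cb m').src i : ℝ) + (R₀ + R) ≤ (P.L ^ k * M0 i : ℕ) - 1) ∧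
        B5Ineq137Torus.T P 0 x₁ (cb m').src ≤ T12) ∧
        ((cb m').src.shift (cb m').dir ∈ (cubeT hPd (P.L ^ k) c fun i => P.L ^ k * M0 i) ∧
        (∀ i, R₀ + R ≤ (boxCoord hPd (P.L ^ k) c ((cb m').src.shift (cb m').dir) i : ℝ) ∧
          (boxCoord hPd (P.L ^ k) c ((cb m').src.shift (cb m').dir) i : ℝ) + (R₀ + R) ≤ (P.L ^ k * M0 i : ℕ) - 1)) := by
      rw [← htgt]
      rcases hJ m' hm' with ⟨h1, h2⟩ | ⟨h1, h2⟩
      · rw [h1, h2]; exact ⟨⟨hmem0, hdeep0, hclose0⟩, hmem1, hdeep1⟩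
      · rw [h1, h2]; exact ⟨⟨hmem1, hdeep1, hclose1⟩, hmem0, hdeep0⟩
    obtain ⟨⟨hzmem, hzdeep, hzclose⟩, hzemem, hzedeep⟩ := hends
    -- the support of `f` seen from the bond: `≥ D − T12`
    set D' : ℝ := max (D - T12) 0 with hD'def
    have hD'0 : 0 ≤ D' := le_max_right _ _
    have hD'supp : ∀ y, f y ≠ 0 → D' ≤ B5Ineq137Torus.T P 0 (cb m').src y := by
      intro y hy
      refine max_le ?_ (B5Ineq137Torus.T_nonneg P 0 _ y)
      have h1 := hsupp₁ y hy
      have h2 := B5Ineq137Torus.T_triangle P 0 x₁ (cb m').src y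
      linarith
    have hder := G1 (cb m').src (cb m').dir hzmem hzdeep hzemem hzedeep f F D' hF hD'0 hD'supp
    rw [← covD_sub, ← hb] at hder
    refine hder.trans (mul_le_mul_of_nonneg_left ?_ (P.spacing_pos k).le)
    -- the exponent: `D' ≥ D − T12 ≥ D − L^k`
    have hexpD' : Real.exp (-(δ₀ / 2 * (((P.L : ℝ) ^ k)⁻¹ * D'))) ≤ Real.exp (δ₀ / 2) * Ex := by
      have h1 : D - T12 ≤ D' := le_max_left _ _
      have h2 : ((P.L : ℝ) ^ k)⁻¹ * T12 ≤ 1 := by rw [inv_mul_le_iff₀ hLk, mul_one]; exact hnear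
      have h3 : -(δ₀ / 2 * (((P.L : ℝ) ^ k)⁻¹ * D')) ≤ δ₀ / 2 + -(δ₀ / 2 * (((P.L : ℝ) ^ k)⁻¹ * D)) := by
        have h4 : δ₀ / 2 * (((P.L : ℝ) ^ k)⁻¹ * (D - T12)) ≤ δ₀ / 2 * (((P.L : ℝ) ^ k)⁻¹ * D') :=
          mul_le_mul_of_nonneg_left (mul_le_mul_of_nonneg_left h1 hLkinv.le) (by positivity)
        have h6 : δ₀ / 2 * (((P.L : ℝ) ^ k)⁻¹ * T12) ≤ δ₀ / 2 * 1 := mul_le_mul_of_nonneg_left h2 (by positivity)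
        have h7 : δ₀ / 2 * (((P.L : ℝ) ^ k)⁻¹ * (D - T12)) =
            δ₀ / 2 * (((P.L : ℝ) ^ k)⁻¹ * D) - δ₀ / 2 * (((P.L : ℝ) ^ k)⁻¹ * T12) := by ring
        linarith
      calc Real.exp (-(δ₀ / 2 * (((P.L : ℝ) ^ k)⁻¹ * D'))) ≤ Real.exp (δ₀ / 2 + -(δ₀ / 2 * (((P.L : ℝ) ^ k)⁻¹ * D))) :=
            Real.exp_le_exp.2 h3
        _ = Real.exp (δ₀ / 2) * Ex := by rw [Real.exp_add]
    rw [hXdef]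
    calc C₁ * Br * Real.exp (-(δ₀ / 2 * (((P.L : ℝ) ^ k)⁻¹ * D'))) * F
        ≤ C₁ * Br * (Real.exp (δ₀ / 2) * Ex) * F :=
          mul_le_mul_of_nonneg_right (mul_le_mul_of_nonneg_left hexpD' (by positivity)) hF0
      _ = C₁ * Real.exp (δ₀ / 2) * Br * Ex * F := by ring
  -- FAR PAIRS: the value member at both end points
  have hval : (P.L : ℝ) ^ k < T12 → ‖ψ x₁‖ ≤ P.spacing k ^ 2 * Y ∧ ‖ψ x₂‖ ≤ P.spacing k ^ 2 * Y := by
    intro _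
    have hv : ∀ x : Balaban1983to89.Site P 0,
        ‖ψL x - ψΩ x‖ ≤ P.spacing k ^ 2 * (c₀ * (((⌊(((P.L : ℝ) ^ k) - 1 + R₀) / s⌋₊ : ℝ) + 3) ^ (d + 1) *
            Real.exp (-(δ₀ * (((P.L : ℝ) ^ k)⁻¹ * (2 * R)))) + Real.exp (-(δ₀ / 2 * (((P.L : ℝ) ^ k)⁻¹ * R₁)))) *
          Real.exp (-(δ₀ / 2 * (((P.L : ℝ) ^ k)⁻¹ * D))) * F) → ‖ψ x‖ ≤ P.spacing k ^ 2 * Y := by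
      intro x hx
      rw [← hψ]
      refine hx.trans (mul_le_mul_of_nonneg_left ?_ (sq_nonneg _))
      rw [hYdef, ← hmdef, ← hEdef]
      have hbr_le : m * Real.exp (-(δ₀ * (((P.L : ℝ) ^ k)⁻¹ * (2 * R)))) + Real.exp (-(δ₀ / 2 * (((P.L : ℝ) ^ k)⁻¹ * R₁))) ≤ Br := by
        rw [hBrdef]
        refine add_le_add ?_ ?_
        · calc m * Real.exp (-(δ₀ * (((P.L : ℝ) ^ k)⁻¹ * (2 * R)))) ≤ m * ER := mul_le_mul_of_nonneg_left hER_2 hm0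
            _ = m * 1 * ER := by ring
            _ ≤ m * br * ER := mul_le_mul_of_nonneg_right (mul_le_mul_of_nonneg_left hbr1 hm0) hER0.le
        · calc Real.exp (-(δ₀ / 2 * (((P.L : ℝ) ^ k)⁻¹ * R₁))) ≤ ER₁ := hER₁_2
            _ = 1 * ER₁ := (one_mul _).symm
            _ ≤ br₁ * ER₁ := mul_le_mul_of_nonneg_right hbr₁1 hER₁0.le
      exact mul_le_mul_of_nonneg_right (mul_le_mul_of_nonneg_right (mul_le_mul_of_nonneg_left hbr_le hc₀) hE0.le) hF0
    exact ⟨hv x₁ (G2 x₁ hx₁ hdeep₁ f F D hF hD hsupp₁), hv x₂ (G2 x₂ hx₂ hdeep₂ f F D hF hD hsupp₂)⟩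
  have key := weighted_transport_sub_le U ψ hθ0 hθ1 (by positivity : (0 : ℝ) ≤ (d : ℝ) + 1) hX0 hY0 hsq0 hsqn hJ hnle hbond hval
  refine key.trans (mul_le_mul_of_nonneg_left ?_ (sq_nonneg _))
  rw [hXdef, hYdef, hCdef]
  have h2 : 2 * (c₀ * Br * Ex * F) ≤ 2 * c₀ * Real.exp (δ₀ / 2) * Br * Ex * F := by
    have : c₀ * Br * Ex * F ≤ c₀ * Real.exp (δ₀ / 2) * Br * Ex * F := by
      have h0 : 0 ≤ c₀ * Br * Ex * F := by positivity
      calc c₀ * Br * Ex * F = 1 * (c₀ * Br * Ex * F) := (one_mul _).symm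
        _ ≤ Real.exp (δ₀ / 2) * (c₀ * Br * Ex * F) := mul_le_mul_of_nonneg_right he1 h0
        _ = c₀ * Real.exp (δ₀ / 2) * Br * Ex * F := by ring
    linarith
  calc ((d : ℝ) + 1) * (C₁ * Real.exp (δ₀ / 2) * Br * Ex * F) + 2 * (c₀ * Br * Ex * F)
      ≤ ((d : ℝ) + 1) * (C₁ * Real.exp (δ₀ / 2) * Br * Ex * F) + 2 * c₀ * Real.exp (δ₀ / 2) * Br * Ex * F := add_le_add le_rfl h2
    _ = (((d : ℝ) + 1) * C₁ + 2 * c₀) * Real.exp (δ₀ / 2) * Br * Ex * F := by ring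

/-! ## §4 The member along the chart staircase -/

/-- **THE HÖLDER MEMBER OF ORDER `θ ≤ 1` OF (2.31), `Ω = T_η`, FROM THE FOUR [6]-INPUTS, ALONG THE CHART STAIRCASE** ([6] (1.9)'s form: *"Here
Γ_{x,x′} denotes a shortest contour connecting the points x, x′"*): with the constant of `holder231_wholeTorus_of_inputs`, for every pair
`x₁, x₂ ∈ Ω₀` at chart depth `≥ R₀ + R` with `|x₁ − x₂|_T ≤ R₀ + R` THERE IS a bond chain `Γ` from `x₁` to `x₂` of `≤ (d+1)|x₁ − x₂|_T` steps
(gen 28's chart staircase `exists_admissible_contour`) along which, for every `0 ≤ θ ≤ 1` and every `f` (`‖f‖_∞ ≤ F`) supported at sup-torus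
distance `≥ D ≥ 0` from both points, the bound of `holder231_wholeTorus_of_inputs` holds.
[cite: BalabanImbrieJaffe1988, (2.31) p.263] [cite: Balaban1983RegularityDecay, Theorem p.573 (1.9)] -/
theorem exists_contour_holder231_wholeTorus_of_inputs (d : ℕ) {c₀ : ℝ} (hc₀ : 0 ≤ c₀) :
    ∃ C : ℝ, 0 < C ∧ ∀ (P : Params) (hPd : P.d = d + 1) (a : ℝ) (k : ℕ), 1 ≤ k → k ≤ P.K →
      ∀ (U : GaugeField P 0 U1) (δ₀ ρ : ℝ), 0 < δ₀ → 0 ≤ ρ →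
      -- (H1) the (1.11)–(1.12) covariant-derivative closeness member for the fitting no-wrap cubes `□ ⊂ T_η`
      (∀ (c' M' : Fin (d + 1) → ℕ), (∀ i, 1 ≤ M' i) → (∀ i, c' i * P.L ^ k + P.L ^ k * M' i ≤ P.sitesPerDir 0) →
          (∀ i, P.L ^ k * M' i < P.sitesPerDir 0) →
        ∀ (x : Balaban1983to89.Site P 0) (μ : Fin P.d), x ∈ (cubeT hPd (P.L ^ k) c' fun i => P.L ^ k * M' i) →
          x.shift μ ∈ (cubeT hPd (P.L ^ k) c' fun i => P.L ^ k * M' i) →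
          (∀ w, w ∉ (cubeT hPd (P.L ^ k) c' fun i => P.L ^ k * M' i) → ρ ≤ B5Ineq137Torus.T P 0 x w) →
        ∀ (g : Balaban1983to89.Site P 0 → ℂ) (F D Db Df : ℝ), (∀ y, ‖g y‖ ≤ F) →
          (∀ y, y ∉ (cubeT hPd (P.L ^ k) c' fun i => P.L ^ k * M' i) → g y = 0) →
          0 ≤ D → (∀ y, g y ≠ 0 → D ≤ B5Ineq137Torus.T P 0 x y) →
          0 ≤ Db → (∀ w, w ∉ (cubeT hPd (P.L ^ k) c' fun i => P.L ^ k * M' i) → Db ≤ B5Ineq137Torus.T P 0 x w) →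
          0 ≤ Df → (∀ y, g y ≠ 0 → ∀ w, w ∉ (cubeT hPd (P.L ^ k) c' fun i => P.L ^ k * M' i) → Df ≤ B5Ineq137Torus.T P 0 y w) →
          ‖covD P.eps⁻¹ (cfg U) (gBox (B1RG242Torus.α P a k * (P.L : ℝ) ^ (k * P.d)) P.eps⁻¹ U k
                  (cubeT hPd (P.L ^ k) c' fun i => P.L ^ k * M' i) *ᵥ g) ⟨x, μ⟩ -
              covD P.eps⁻¹ (cfg U) (gBox (B1RG242Torus.α P a k * (P.L : ℝ) ^ (k * P.d)) P.eps⁻¹ U k univ *ᵥ g) ⟨x, μ⟩‖ ≤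
            P.spacing k * (c₀ * Real.exp (-(δ₀ * (((P.L : ℝ) ^ k)⁻¹ * D))) * Real.exp (-(δ₀ * (((P.L : ℝ) ^ k)⁻¹ * (Db + Df)))) * F)) →
      -- (H2) the (1.11)–(1.12) value closeness member for the same cubes and rows
      (∀ (c' M' : Fin (d + 1) → ℕ), (∀ i, 1 ≤ M' i) → (∀ i, c' i * P.L ^ k + P.L ^ k * M' i ≤ P.sitesPerDir 0) →
          (∀ i, P.L ^ k * M' i < P.sitesPerDir 0) →
        ∀ (x : Balaban1983to89.Site P 0), x ∈ (cubeT hPd (P.L ^ k) c' fun i => P.L ^ k * M' i) →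
          (∀ w, w ∉ (cubeT hPd (P.L ^ k) c' fun i => P.L ^ k * M' i) → ρ ≤ B5Ineq137Torus.T P 0 x w) →
        ∀ (g : Balaban1983to89.Site P 0 → ℂ) (F D Db Df : ℝ), (∀ y, ‖g y‖ ≤ F) →
          (∀ y, y ∉ (cubeT hPd (P.L ^ k) c' fun i => P.L ^ k * M' i) → g y = 0) →
          0 ≤ D → (∀ y, g y ≠ 0 → D ≤ B5Ineq137Torus.T P 0 x y) →
          0 ≤ Db → (∀ w, w ∉ (cubeT hPd (P.L ^ k) c' fun i => P.L ^ k * M' i) → Db ≤ B5Ineq137Torus.T P 0 x w) →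
          0 ≤ Df → (∀ y, g y ≠ 0 → ∀ w, w ∉ (cubeT hPd (P.L ^ k) c' fun i => P.L ^ k * M' i) → Df ≤ B5Ineq137Torus.T P 0 y w) →
          ‖(gBox (B1RG242Torus.α P a k * (P.L : ℝ) ^ (k * P.d)) P.eps⁻¹ U k (cubeT hPd (P.L ^ k) c' fun i => P.L ^ k * M' i) *ᵥ g) x -
              (gBox (B1RG242Torus.α P a k * (P.L : ℝ) ^ (k * P.d)) P.eps⁻¹ U k univ *ᵥ g) x‖ ≤
            P.spacing k ^ 2 * (c₀ * Real.exp (-(δ₀ * (((P.L : ℝ) ^ k)⁻¹ * D))) * Real.exp (-(δ₀ * (((P.L : ℝ) ^ k)⁻¹ * (Db + Df)))) * F)) →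
      -- (H3) the (1.10) covariant-derivative member of `G_k(T_η,u)`
      (∀ (x : Balaban1983to89.Site P 0) (μ : Fin P.d) (g : Balaban1983to89.Site P 0 → ℂ) (F D : ℝ), (∀ y, ‖g y‖ ≤ F) → 0 ≤ D →
          (∀ y, g y ≠ 0 → D ≤ B5Ineq137Torus.T P 0 x y) →
          ‖covD P.eps⁻¹ (cfg U) (gBox (B1RG242Torus.α P a k * (P.L : ℝ) ^ (k * P.d)) P.eps⁻¹ U k univ *ᵥ g) ⟨x, μ⟩‖ ≤
            P.spacing k * (c₀ * Real.exp (-(δ₀ * (((P.L : ℝ) ^ k)⁻¹ * D))) * F)) →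
      -- (H4) the (1.10) value member of `G_k(T_η,u)`
      (∀ (x : Balaban1983to89.Site P 0) (g : Balaban1983to89.Site P 0 → ℂ) (F D : ℝ), (∀ y, ‖g y‖ ≤ F) → 0 ≤ D →
          (∀ y, g y ≠ 0 → D ≤ B5Ineq137Torus.T P 0 x y) →
          ‖(gBox (B1RG242Torus.α P a k * (P.L : ℝ) ^ (k * P.d)) P.eps⁻¹ U k univ *ᵥ g) x‖ ≤
            P.spacing k ^ 2 * (c₀ * Real.exp (-(δ₀ * (((P.L : ℝ) ^ k)⁻¹ * D))) * F)) →
      ∀ (c M0 : Fin (d + 1) → ℕ), (∀ i, 1 ≤ M0 i) →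
        (∀ i, c i * P.L ^ k + P.L ^ k * M0 i ≤ P.sitesPerDir 0) → (∀ i, P.L ^ k * M0 i < P.sitesPerDir 0) →
      ∀ (s W : ℕ), 1 ≤ s → ∀ (R R₀ R₁ : ℝ), ρ + 1 < R → 0 ≤ R₁ → R₁ < R₀ → 2 * (s : ℝ) / 3 + R₀ / 2 + R ≤ W →
        (∀ i, ((P.L ^ k * M0 i : ℕ) : ℝ) + R ≤ P.sitesPerDir 0) →
      ∀ (x₁ x₂ : Balaban1983to89.Site P 0),
        x₁ ∈ (cubeT hPd (P.L ^ k) c fun i => P.L ^ k * M0 i) →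
        (∀ i, R₀ + R ≤ (boxCoord hPd (P.L ^ k) c x₁ i : ℝ) ∧ (boxCoord hPd (P.L ^ k) c x₁ i : ℝ) + (R₀ + R) ≤ (P.L ^ k * M0 i : ℕ) - 1) →
        x₂ ∈ (cubeT hPd (P.L ^ k) c fun i => P.L ^ k * M0 i) →
        (∀ i, R₀ + R ≤ (boxCoord hPd (P.L ^ k) c x₂ i : ℝ) ∧ (boxCoord hPd (P.L ^ k) c x₂ i : ℝ) + (R₀ + R) ≤ (P.L ^ k * M0 i : ℕ) - 1) →
        B5Ineq137Torus.T P 0 x₁ x₂ ≤ R₀ + R →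
      ∃ (N : ℕ) (sq : ℕ → Balaban1983to89.Site P 0) (cb : ℕ → PBond P 0), sq 0 = x₁ ∧ sq N = x₂ ∧
        (∀ m < N, Joins (cb m) (sq m) (sq (m + 1))) ∧ (N : ℝ) ≤ ((d : ℝ) + 1) * B5Ineq137Torus.T P 0 x₁ x₂ ∧
      ∀ (θ : ℝ), 0 ≤ θ → θ ≤ 1 →
      ∀ (f : Balaban1983to89.Site P 0 → ℂ) (F D : ℝ), (∀ y, ‖f y‖ ≤ F) → 0 ≤ D →
        (∀ y, f y ≠ 0 → D ≤ B5Ineq137Torus.T P 0 x₁ y) → (∀ y, f y ≠ 0 → D ≤ B5Ineq137Torus.T P 0 x₂ y) →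
        ((P.L : ℝ) ^ k / B5Ineq137Torus.T P 0 x₁ x₂) ^ θ *
          ‖toC (chainHol sq cb U N) *
              ((gLocT (B1RG242Torus.α P a k * (P.L : ℝ) ^ (k * P.d)) P.eps⁻¹ U k
                  (cubeFam hPd (P.L ^ k) c M0 s W) (lamFam hPd (P.L ^ k) c M0 s) (cutoff R₁ R₀ (B5Ineq137Torus.T P 0)) *ᵥ f) x₂ -
                (gBox (B1RG242Torus.α P a k * (P.L : ℝ) ^ (k * P.d)) P.eps⁻¹ U k univ *ᵥ f) x₂) -
            ((gLocT (B1RG242Torus.α P a k * (P.L : ℝ) ^ (k * P.d)) P.eps⁻¹ U k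
                  (cubeFam hPd (P.L ^ k) c M0 s W) (lamFam hPd (P.L ^ k) c M0 s) (cutoff R₁ R₀ (B5Ineq137Torus.T P 0)) *ᵥ f) x₁ -
                (gBox (B1RG242Torus.α P a k * (P.L : ℝ) ^ (k * P.d)) P.eps⁻¹ U k univ *ᵥ f) x₁)‖ ≤
          P.spacing k ^ 2 * (C * Real.exp (δ₀ / 2) *
            ((⌊(((P.L : ℝ) ^ k) - 1 + R₀) / s⌋₊ + 3) ^ (d + 1) * (1 + (P.L : ℝ) ^ k * ((R₀ - R₁)⁻¹ + (s : ℝ)⁻¹)) *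
              Real.exp (-(δ₀ * (((P.L : ℝ) ^ k)⁻¹ * (2 * R - 1)))) +
            (1 + (P.L : ℝ) ^ k * (R₀ - R₁)⁻¹) * Real.exp (-(δ₀ / 2 * (((P.L : ℝ) ^ k)⁻¹ * (R₁ - 1))))) *
            Real.exp (-(δ₀ / 2 * (((P.L : ℝ) ^ k)⁻¹ * D))) * F) := by
  obtain ⟨C, hC, G⟩ := holder231_wholeTorus_of_inputs d hc₀
  refine ⟨C, hC, ?_⟩
  intro P hPd a k hk1 hkK U δ₀ ρ hδ₀ hρ H1 H2 H3 H4 c M0 hM0 hfit0 hN0 s W hs R R₀ R₁ hR hR₁ hR10 hW hgap x₁ x₂ hx₁ hdeep₁ hx₂ hdeep₂ hT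
  obtain ⟨N, sq, cb, h0, hN, hJ, hNle, hchain⟩ := exists_admissible_contour hPd hfit0 hx₁ hdeep₁ hx₂ hdeep₂ hT
  refine ⟨N, sq, cb, h0, hN, hJ, hNle, fun θ hθ0 hθ1 f F D hF hD hD₁ hD₂ => ?_⟩
  have hchain' : ∀ m ≤ N, sq m ∈ (cubeT hPd (P.L ^ k) c fun i => P.L ^ k * M0 i) ∧
      (∀ i, R₀ + R ≤ (boxCoord hPd (P.L ^ k) c (sq m) i : ℝ) ∧ (boxCoord hPd (P.L ^ k) c (sq m) i : ℝ) + (R₀ + R) ≤ (P.L ^ k * M0 i : ℕ) - 1) ∧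
      B5Ineq137Torus.T P 0 x₁ (sq m) ≤ B5Ineq137Torus.T P 0 x₁ x₂ := fun m hm => by
    obtain ⟨h1, h2, h3⟩ := hchain m hm
    exact ⟨h1, fun i => by simpa only [min_self] using h2 i, h3⟩
  exact G P hPd a k hk1 hkK U δ₀ ρ hδ₀ hρ H1 H2 H3 H4 c M0 hM0 hfit0 hN0 s W hs R R₀ R₁ hR hR₁ hR10 hW hgap θ hθ0 hθ1 x₁ x₂ N sq cb
    h0 hN hJ hNle hchain' f F D hF hD hD₁ hD₂

end

end Literature.MathematicalPhysics.QuantumFieldTheory.BalabanImbrieJaffe1984to88.BIJ88LocHolder231TorusOfInputs
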